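import Literature.AlgebraicGeometry.Resolution.BlowupsFacts
import Mathlib.AlgebraicGeometry.Properties
import HarnessLib

/-!
# Blowing ups of integral schemes are integral — from the universal property (Stacks 02ND)

Topic: `Literature/AlgebraicGeometry/Resolution`. The named fact `Stacks02ND` of `BlowupsFacts.lean`
(Stacks, Tag 02ND = Lemma 31.33.9: blowing up an integral scheme in a nonzero ideal sheaf gives an
integral scheme) is DISCHARGED here from the universal property `IsBlowup` (`Blowups.lean`) alone:
if `π : X' → X` is a blowing up of the integral scheme `X` along `J ≠ ⊥` then

* `IsBlowup.basicOpen_le_preimage_compl` — on an effective-Cartier chart `W` of `X'` with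
  generator `f`, the basic open `D(f) ⊆ W` lies over the complement `U = X ∖ V(J)` of the centre;
* `IsBlowup.isDomain_sections` — sections of `X'` over a nonempty open lying over `U` form a
  domain (`π⁻¹(U) ≅ U ⊆ X`, `IsBlowup.isIso_compl`); `IsBlowup.isDomain_chart` — hence the
  coordinate ring of every effective-Cartier chart is a domain (it injects into `Γ(D(f))`, the
  localization at the regular element `f`);
* `IsBlowup.isReduced`, `IsBlowup.dense_preimage_compl`, `IsBlowup.irreducibleSpace`,
  `IsBlowup.isIntegral` — `X'` is reduced (stalks are localizations of domains), `π⁻¹(U)` is dense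
  (every nonempty open contains a nonempty `D(f)`), `X'` is irreducible, hence integral;
* `stacks02ND_holds : Stacks02ND` (and `Stacks02ND_holds`, the discharge under the `<Fact>_holds`
  naming convention); unconditional `IsBlowup.isBirational'` (a blowing up of an
  integral scheme along a nonzero ideal sheaf is birational) and `IsBlowup.isResolution'`
  (with `Stacks02NS` and a regular source, a resolution of singularities).

## Sources

* The Stacks Project, Tag 02ND (Lemma 31.33.9), Tag 02OS (Lemma 31.33.4). [StacksProject]
-/

noncomputable section

open CategoryTheory CategoryTheory.Limits AlgebraicGeometry TopologicalSpace Opposite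

namespace Literature.AlgebraicGeometry.Resolution

universe u

variable {X' X : Scheme.{u}} {π : X' ⟶ X} {J : X.IdealSheafData}

/-- The open complement of the centre. [folklore] -/
def centreCompl (J : X.IdealSheafData) : X.Opens :=
  ⟨(J.support : Set X)ᶜ, J.support.isClosed.isOpen_compl⟩

/-- The complement of the centre is nonempty when `J ≠ ⊥` and `X` is reduced. [folklore] -/
theorem centreCompl_nonempty [IsReduced X] (hJ : J ≠ ⊥) : ((centreCompl J : X.Opens) : Set X).Nonempty := by
  by_contra hne
  apply hJ
  rw [← Scheme.IdealSheafData.support_eq_top_iff]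
  apply TopologicalSpace.Closeds.ext
  rw [Set.not_nonempty_iff_eq_empty] at hne
  exact Set.compl_empty_iff.mp hne

/-- **On an effective-Cartier chart the basic open of the generator lies over the complement of
the centre**: if `(J.comap π)(W) = (f)` then `D(f) ⊆ π⁻¹(X ∖ V(J))` (at a point of `D(f)` over
`V(J)` the generator `f` would vanish). [folklore] -/
theorem IsBlowup.basicOpen_le_preimage_compl (W : X'.affineOpens) (f : Γ(X', W))
    (hJW : (J.comap π).ideal W = Ideal.span {f}) :
    X'.basicOpen f ≤ π ⁻¹ᵁ centreCompl J := by
  intro y hy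
  change π y ∉ (J.support : Set X)
  intro hyJ
  have hy' : y ∈ ((J.comap π).support : Set X') ∩ (W : X'.Opens) := by
    refine ⟨?_, X'.basicOpen_le _ hy⟩
    rw [Scheme.IdealSheafData.support_comap]
    exact hyJ
  rw [Scheme.IdealSheafData.coe_support_inter] at hy'
  exact (X'.mem_zeroLocus_iff _ y).mp hy'.1 f (by rw [hJW]; exact Ideal.mem_span_singleton_self _) hy

/-- The morphism `π⁻¹(X ∖ V(J)) → X` is an open immersion (the blowing up is an isomorphism over
the complement of the centre). [folklore] -/
theorem IsBlowup.isOpenImmersion_preimage_compl_ι (hπ : IsBlowup π J) :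
    IsOpenImmersion ((π ⁻¹ᵁ centreCompl J).ι ≫ π) := by
  haveI : IsIso (π ∣_ centreCompl J) := hπ.isIso_compl
  rw [← morphismRestrict_ι]
  infer_instance

/-- **Sections of a blowing up over a nonempty open lying over the complement of the centre form
a domain** (`X` integral): `π⁻¹(X ∖ V(J)) ≅ X ∖ V(J)` is an open subscheme of `X`. [folklore] -/
theorem IsBlowup.isDomain_sections [IsIntegral X] (hπ : IsBlowup π J) (O : X'.Opens)
    (hO : O ≤ π ⁻¹ᵁ centreCompl J) (hne : ((O : X'.Opens) : Set X').Nonempty) :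
    IsDomain Γ(X', O) := by
  let V : X'.Opens := π ⁻¹ᵁ centreCompl J
  let F : (V : Scheme.{u}) ⟶ X := V.ι ≫ π
  haveI : IsOpenImmersion F := hπ.isOpenImmersion_preimage_compl_ι
  let B : (V : Scheme.{u}).Opens := V.ι ⁻¹ᵁ O
  -- `Γ(X', O) → Γ(V, B)` is an isomorphism (`O ⊆ V = range V.ι`)
  have h1 : IsIso (V.ι.app O) := V.ι.isIso_app O (by rwa [Scheme.Opens.opensRange_ι])
  -- `Γ(X, F '' B) ≅ Γ(V, B)` and the former is a domain
  have hne' : Nonempty (F ''ᵁ B : X.Opens) := by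
    obtain ⟨x, hx⟩ := hne
    refine ⟨⟨F ⟨x, hO hx⟩, ⟨x, hO hx⟩, ?_, rfl⟩⟩
    change (V.ι ⟨x, hO hx⟩) ∈ O
    exact hx
  haveI : IsDomain Γ(X, F ''ᵁ B) := IsIntegral.component_integral _
  let e₁ : Γ(X, F ''ᵁ B) ≅ Γ(V, B) := F.appIso B
  haveI : IsDomain Γ(V, B) :=
    e₁.commRingCatIsoToRingEquiv.symm.injective.isDomain e₁.commRingCatIsoToRingEquiv.symm.toRingHom
  exact (asIso (V.ι.app O)).commRingCatIsoToRingEquiv.injective.isDomain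
    (asIso (V.ι.app O)).commRingCatIsoToRingEquiv.toRingHom

/-- A regular element of a nontrivial commutative ring is not nilpotent. [folklore] -/
theorem not_isNilpotent_of_mem_nonZeroDivisors {A : Type*} [CommRing A] [Nontrivial A] {f : A}
    (hf : f ∈ nonZeroDivisors A) : ¬ IsNilpotent f := by
  rintro ⟨n, hn⟩
  have : (f ^ n) ∈ nonZeroDivisors A := Submonoid.pow_mem _ hf n
  rw [hn] at this
  exact zero_notMem_nonZeroDivisors this

/-- On an effective-Cartier chart `W ∋ x'` the basic open `D(f)` of the generator is nonempty
(`f` is regular in the nontrivial ring `Γ(W)`, hence not nilpotent). [folklore] -/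
theorem nonempty_basicOpen_of_mem_nonZeroDivisors (W : X'.affineOpens) {x' : X'}
    (hx' : x' ∈ (W : X'.Opens)) (f : Γ(X', W)) (hf : f ∈ nonZeroDivisors Γ(X', W)) :
    ((X'.basicOpen f : X'.Opens) : Set X').Nonempty := by
  haveI : Nontrivial Γ(X', W) := by
    obtain ⟨p⟩ : Nonempty (PrimeSpectrum Γ(X', W)) := ⟨W.2.primeIdealOf ⟨x', hx'⟩⟩
    exact ⟨⟨0, 1, fun h => p.isPrime.ne_top (Ideal.eq_top_of_isUnit_mem _ p.asIdeal.zero_mem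
      (by rw [h]; exact isUnit_one))⟩⟩
  have hnil := not_isNilpotent_of_mem_nonZeroDivisors hf
  rw [← PrimeSpectrum.basicOpen_eq_bot_iff] at hnil
  obtain ⟨p, hp⟩ : ((PrimeSpectrum.basicOpen f : Opens (PrimeSpectrum Γ(X', W))) :
      Set (PrimeSpectrum Γ(X', W))).Nonempty := by
    by_contra h
    apply hnil
    exact Opens.ext (Set.not_nonempty_iff_eq_empty.mp h)
  refine ⟨W.2.fromSpec p, ?_⟩
  change p ∈ W.2.fromSpec ⁻¹ᵁ X'.basicOpen f
  rw [W.2.fromSpec_preimage_basicOpen]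
  exact hp

/-- **The coordinate ring of an effective-Cartier chart of a blowing up of an integral scheme is a
domain**: it injects into `Γ(D(f)) = Γ(W)[1/f]` (`f` regular), a domain by
`IsBlowup.isDomain_sections`. [folklore] -/
theorem IsBlowup.isDomain_chart [IsIntegral X] (hπ : IsBlowup π J) (W : X'.affineOpens)
    {x' : X'} (hx' : x' ∈ (W : X'.Opens)) (f : Γ(X', W)) (hf : f ∈ nonZeroDivisors Γ(X', W))
    (hJW : (J.comap π).ideal W = Ideal.span {f}) : IsDomain Γ(X', W) := by
  haveI := W.2.isLocalization_basicOpen f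
  have hinj : Function.Injective (algebraMap Γ(X', W) Γ(X', X'.basicOpen f)) :=
    IsLocalization.injective (M := Submonoid.powers f) Γ(X', X'.basicOpen f)
      (Submonoid.powers_le.mpr hf)
  haveI : IsDomain Γ(X', X'.basicOpen f) :=
    hπ.isDomain_sections _ (IsBlowup.basicOpen_le_preimage_compl W f hJW)
      (nonempty_basicOpen_of_mem_nonZeroDivisors W hx' f hf)
  exact hinj.isDomain (algebraMap Γ(X', W) Γ(X', X'.basicOpen f))

/-- **A blowing up of an integral scheme is reduced** (its stalks are localizations of the domains
`Γ(W)`). [cite: StacksProject, Tag 02ND] -/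
theorem IsBlowup.isReduced [IsIntegral X] (hπ : IsBlowup π J) : IsReduced X' := by
  haveI : ∀ x' : X', _root_.IsReduced (X'.presheaf.stalk x') := fun x' => by
    obtain ⟨W, hx', f, hf, hJW⟩ := hπ.isEffectiveCartier x'
    haveI : IsDomain Γ(X', W) := hπ.isDomain_chart W hx' f hf hJW
    let y : (W : X'.Opens) := ⟨x', hx'⟩
    letI := X'.presheaf.algebra_section_stalk y
    haveI := W.2.isLocalization_stalk y
    haveI : IsDomain (X'.presheaf.stalk y.1) :=
      IsLocalization.isDomain_of_le_nonZeroDivisors (M := (W.2.primeIdealOf y).asIdeal.primeCompl)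
        _ (Ideal.primeCompl_le_nonZeroDivisors _)
    change _root_.IsReduced (X'.presheaf.stalk y.1)
    infer_instance
  exact isReduced_of_isReduced_stalk X'

/-- **The preimage of the complement of the centre is dense in the blowing up**: every nonempty
open contains an effective-Cartier chart `W₁` and its nonempty `D(f₁) ⊆ π⁻¹(X ∖ V(J))`.
[cite: StacksProject, Tag 02ND] -/
theorem IsBlowup.dense_preimage_compl (hπ : IsBlowup π J) :
    Dense ((π ⁻¹ᵁ centreCompl J : X'.Opens) : Set X') := by
  rw [dense_iff_inter_open]
  intro O hO hOne
  obtain ⟨x', hx'O⟩ := hOne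
  obtain ⟨W, hx'W, f, hf, hJW⟩ := hπ.isEffectiveCartier x'
  -- shrink to an affine open inside `O ∩ W`
  obtain ⟨W₁, hW₁, hx'W₁, hW₁le⟩ := exists_isAffineOpen_mem_and_subset (X := X') (x := x')
    (U := ⟨O, hO⟩ ⊓ (W : X'.Opens)) ⟨hx'O, hx'W⟩
  have h₁W : (W₁ : X'.Opens) ≤ W := fun y hy => (hW₁le hy).2
  have h₁O : (W₁ : Set X') ⊆ O := fun y hy => (hW₁le hy).1
  let f₁ : Γ(X', W₁) := X'.presheaf.map (homOfLE h₁W).op f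
  have hf₁ : f₁ ∈ nonZeroDivisors Γ(X', W₁) :=
    map_mem_nonZeroDivisors_of_le (U := ⟨W₁, hW₁⟩) (V := W) h₁W hf
  have hJW₁ : (J.comap π).ideal ⟨W₁, hW₁⟩ = Ideal.span {f₁} := by
    rw [← (J.comap π).map_ideal (U := ⟨W₁, hW₁⟩) (V := W) h₁W, hJW, Ideal.map_span,
      Set.image_singleton]
    rfl
  obtain ⟨y, hy⟩ := nonempty_basicOpen_of_mem_nonZeroDivisors ⟨W₁, hW₁⟩ hx'W₁ f₁ hf₁
  exact ⟨y, h₁O (X'.basicOpen_le f₁ hy), IsBlowup.basicOpen_le_preimage_compl ⟨W₁, hW₁⟩ f₁ hJW₁ hy⟩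

/-- **A blowing up of an integral scheme along a nonzero ideal sheaf is irreducible**: the dense
open `π⁻¹(X ∖ V(J)) ≅ X ∖ V(J)` is irreducible. [cite: StacksProject, Tag 02ND] -/
theorem IsBlowup.irreducibleSpace [IsIntegral X] (hπ : IsBlowup π J) (hJ : J ≠ ⊥) :
    IrreducibleSpace X' := by
  let V : X'.Opens := π ⁻¹ᵁ centreCompl J
  haveI : IsIso (π ∣_ centreCompl J) := hπ.isIso_compl
  -- `V` is irreducible: homeomorphic to the nonempty open `X ∖ V(J)` of the irreducible `X`
  have hUirr : IsPreirreducible ((centreCompl J : X.Opens) : Set X) :=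
    (PreirreducibleSpace.isPreirreducible_univ (X := X)).open_subset (centreCompl J).2
      (Set.subset_univ _)
  haveI : PreirreducibleSpace (centreCompl J : X.Opens) := Subtype.preirreducibleSpace hUirr
  have hVuniv : IsPreirreducible (Set.univ : Set V) := by
    have e := (asIso (π ∣_ centreCompl J)).schemeIsoToHomeo
    have : (Set.univ : Set V) = e.symm '' Set.univ := by
      rw [Set.image_univ, e.symm.range_coe]
    rw [this]
    exact (PreirreducibleSpace.isPreirreducible_univ).image _ e.symm.continuous.continuousOn
  have hVirr : IsPreirreducible (V : Set X') := by
    have : (V : Set X') = V.ι '' Set.univ := by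
      rw [Set.image_univ, Scheme.Opens.range_ι]
    rw [this]
    exact hVuniv.image _ V.ι.continuous.continuousOn
  have hdense := hπ.dense_preimage_compl
  haveI : PreirreducibleSpace X' := ⟨by
    rw [← hdense.closure_eq]
    exact hVirr.closure⟩
  obtain ⟨x, hx⟩ := centreCompl_nonempty (J := J) hJ
  haveI : Nonempty X' := ⟨((asIso (π ∣_ centreCompl J)).inv ⟨x, hx⟩).1⟩
  exact ⟨inferInstance⟩

/-- **Stacks 02ND from the universal property: a blowing up of an integral scheme along a nonzero
ideal sheaf is integral.** [cite: StacksProject, Tag 02ND] -/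
theorem IsBlowup.isIntegral [IsIntegral X] (hπ : IsBlowup π J) (hJ : J ≠ ⊥) : IsIntegral X' := by
  haveI := hπ.isReduced
  haveI := hπ.irreducibleSpace hJ
  exact isIntegral_of_irreducibleSpace_of_isReduced X'

/-- **`Stacks02ND` holds** (discharged from the universal property `IsBlowup` alone).
[cite: StacksProject, Tag 02ND] -/
theorem stacks02ND_holds : Stacks02ND.{u} :=
  fun _ _ _ _ _ hJ hπ => hπ.isIntegral hJ

/-- **A blowing up of an integral scheme along a nonzero ideal sheaf is birational**,
unconditionally (`IsBlowup.isBirational` of `BlowupsFacts.lean` fed with `stacks02ND_holds`).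
[cite: StacksProject, Tag 02ND and Tag 02OS] -/
theorem IsBlowup.isBirational' [IsIntegral X] (hπ : IsBlowup π J) (hJ : J ≠ ⊥) : IsBirational π :=
  hπ.isBirational stacks02ND_holds hJ

/-- **A regular blowing up of a locally Noetherian integral scheme along a nonzero ideal sheaf is
a resolution of singularities**, given only properness of blowing ups (`Stacks02NS`).
[cite: StacksProject, Tag 02NS] -/
theorem IsBlowup.isResolution' (h02 : Stacks02NS.{u}) [IsIntegral X] [IsLocallyNoetherian X]
    (hπ : IsBlowup π J) (hJ : J ≠ ⊥) (hreg : Scheme.IsRegular X') : IsResolution π :=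
  hπ.isResolution h02 stacks02ND_holds hJ hreg

/-- **`Stacks02ND` holds**, under the `<Fact>_holds` name of the discharge convention (the proof is
`stacks02ND_holds` above: `X'` is reduced because every effective-Cartier chart ring `Γ(W)` injects
into the domain `Γ(D(f)) ⊆ Γ(π⁻¹(X ∖ V(J)))`, and irreducible because the irreducible open
`π⁻¹(X ∖ V(J)) ≅ X ∖ V(J)` is dense). Stacks, Tag 02ND = Lemma 31.33.9: "Let `X` be a scheme. Let
`𝓘 ⊂ 𝒪_X` be a nonzero quasi-coherent sheaf of ideals. If `X` is integral, then the blowup `X'` of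
`X` in `𝓘` is integral." [cite: StacksProject, Tag 02ND] -/
theorem Stacks02ND_holds : Stacks02ND.{u} :=
  stacks02ND_holds

end Literature.AlgebraicGeometry.Resolution

end
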